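import Mathlib
import Summits.Ventures.DiscreteObjects.Mahler.LehmerIrreducible
import Summits.Ventures.DiscreteObjects.Mahler.LehmerSalem

/-!
# Lehmer's number, in one statement (venture `DiscreteObjects`, target L)

Cell `pub-namedobj`, seat `pub-namedobj-mahler` (gen 9). Framing: lottery ticket; floor = certified
bounds/negative ranges.

The object of target (L) — Lehmer's number `λ₁₀ = M(L) = 1.176280818259…`, the conjecturally smallest
Mahler measure `> 1` (Lehmer 1933) — assembled from the kernel files `LehmerExactMeasure` (g2: `M(L)` to
12 digits), `LehmerIrreducible` (g9: `L` irreducible) and `LehmerSalem` (g9: root structure):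

* `lehmer_number` — there is a real `τ` with `1.176280818259 < τ < 1.176280818260`, `M(L) = τ`,
  `L` irreducible of degree `10`, `τ` and `τ⁻¹` roots of `L`, and all other complex roots of `L` on the
  unit circle — i.e. **Lehmer's number is a Salem number of degree 10 with minimal polynomial
  `L = x¹⁰+x⁹-x⁷-x⁶-x⁵-x⁴-x³+x+1`**.
-/

namespace Summit.Ventures.DiscreteObjects.Mahler

open Polynomial

/-- **Lehmer's number.**  `L = x¹⁰+x⁹-x⁷-x⁶-x⁵-x⁴-x³+x+1` is irreducible of degree `10`, and its Mahler
measure `τ = M(L) ∈ (1.176280818259, 1.176280818260)` is a root of `L` together with `τ⁻¹`, all other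
complex roots of `L` lying on the unit circle (a Salem number of degree `10`). -/
theorem lehmer_number : Irreducible lehmerPoly ∧ lehmerPoly.natDegree = 10 ∧
    ∃ τ : ℝ, (1176280818259 / 10 ^ 12 : ℝ) < τ ∧ τ < 1176280818260 / 10 ^ 12 ∧
      intMahlerMeasure lehmerPoly = τ ∧
      (τ : ℂ) ∈ (lehmerPoly.map (Int.castRingHom ℂ)).roots ∧
      ((τ⁻¹ : ℝ) : ℂ) ∈ (lehmerPoly.map (Int.castRingHom ℂ)).roots ∧
      ∀ α ∈ (lehmerPoly.map (Int.castRingHom ℂ)).roots, α = τ ∨ α = ((τ⁻¹ : ℝ) : ℂ) ∨ ‖α‖ = 1 := by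
  obtain ⟨τ, _, hM, hτ, hτinv, hroots⟩ := lehmer_salem
  obtain ⟨hlo, hhi⟩ := lehmer_measure_enclosure
  rw [hM] at hlo hhi
  exact ⟨irreducible_lehmerPoly, lehmerPoly_facts.1, τ, hlo, hhi, hM, hτ, hτinv, hroots⟩

end Summit.Ventures.DiscreteObjects.Mahler
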